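import Summits.BirchSwinnertonDyer.BirchSwinnertonDyer.Theorems.EisensteinPrimesGoodLatticeBDPValueOfNamedFactsV33P
import Summits.BirchSwinnertonDyer.BirchSwinnertonDyer.Theorems.EisensteinPrimesPoitouTateShaNaturalAtTC
import HarnessLib

/-!
# Crux `GoodLatticeBDPValue` (stmt-BirchSwinnertonDyer-19032), line `halves`: THE CRUX BY NAME FROM SIX LITERATURE NAMED FACTS —
# research 5 (one CITE hypothesis) · preprint-grade 1 (one CONTENT hypothesis) · textbook 0; the by-name closure of the LEAD's skeleton v33N

Cell `bsd-eis` (run/shared/lean/pub/bsd-eis/), LEAD seat `bsd-line-x1-p1` gen 11. `--supports stmt-BirchSwinnertonDyer-19032`.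

v32 (`…OfNamedFactsV32.goodLatticeBDPValue_of_namedFacts₃₂`, p716369): the crux BY NAME from 8 names (research 6 · preprint-grade 1 · textbook 1).  Two of
them leave in v33N: the TEXTBOOK conjunct `∀ L [IsTotallyComplex L] (S : Set _), S.Finite → GaloisCohomology.poitouTate_shaRestricted_tateDual_natural_at L S`
(Milne ADT I Thm. 4.10 (a), restricted-natural form, at the finite sets of places of totally complex fields) is the TREE THEOREM
`Summit.BirchSwinnertonDyer.BirchSwinnertonDyer.Theorems.PoitouTateShaNaturalAtTC.forall_poitouTate_shaRestricted_tateDual_natural_at_of_isTotallyComplex`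
(lane «PT-Ш-S-TC» of cell bsd-eis, 2026-08-29), and Greenberg 2016 Prop. 4.1.1 (`prop411_selmer_isAlmostDivisible`) is superfluous at the one instance the line
reads (width seat w5 gen 12's `GoodLatticeBDPValueOfNamedFactsV33P.goodLatticeBDPValue_of_namedFacts₃₃ₚ`, p732651, over cruxlead-20395 g7's p728036/p728414).
Result: `goodLatticeBDPValue_of_namedFacts₃₃ₙ : ⟨(proofThm422 ∧ thm513_disc ∧ thm331 ∧ thmII64) ∧ thm212⟩ → thm222_anacong_goodLattice_of_fullDescentDatum →
Theses.EisensteinPrimes.GoodLatticeBDPValue` := `…₃₃ₚ` fed the Poitou–Tate THEOREM.  The two hypotheses are the two registered stubs of halves v33N VERBATIM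
(`stub_printInputs` [CITE-ONLY — never a proof target, never benched], `stub_anacongOfFullDescentDatum` CONTENT).
BY-NAME SURFACE: 6 = research 5 (CGLS 2022 proof of 4.2.2, 5.1.3 (disc), 2.1.2; Bleher et al. 2020 3.3.1; de Shalit 1987 II.6.4) · preprint-grade 1 (`_of_fullDescentDatum`) ·
textbook 0.  HONEST FRAMING: CONDITIONAL on exactly these six names; closes nothing by itself; no summit statement / BSD / Mazur MC / IMC2 / KY 2.2.2 is proved for
any curve.  What the lane proved in the kernel is Milne I 4.10 (a) (finite `S`, totally complex `K`) in the tree's formulation — nothing beyond that is claimed.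
[claim: KellerYin2024, status: under-review]
[cite: KellerYin2024, Thm. 3.0.8 (IMC2), Thm. 1.4.1, Thms. 2.2.1–2.2.3] [cite: CastellaGrossiLeeSkinner2022, proof of Thm. 4.2.2, Thm. 5.1.3 with (disc), Thm. 2.1.2]
[cite: BleherEtAl2020, §3.3 Thm. 3.3.1] [cite: deShalit1987, II.6.4 Theorem (i)] [cite: Greenberg2016Selmer, Prop. 4.1.1, Prop. 2.6.3 (c)] [cite: MilneADT2006, I Thm. 4.10 (a), I Thm. 5.1]
-/

noncomputable section

set_option autoImplicit false
set_option linter.dupNamespace false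

namespace Summit.BirchSwinnertonDyer.BirchSwinnertonDyer.Theorems.GoodLatticeBDPValueOfNamedFactsV33N

open NumberField Literature.NumberTheory.EllipticCurves.CastellaGrossiLeeSkinner2022 Literature.NumberTheory.EllipticCurves.BCGKPST2020
  Literature.NumberTheory.EllipticCurves.DeShalit1987 Literature.NumberTheory.EllipticCurves.KellerYin2024

/-- **THE CRUX BY NAME — `Theses.EisensteinPrimes.GoodLatticeBDPValue` — from SIX LITERATURE NAMED FACTS (the v33N surface: research 5 in ONE cite hypothesis ·
preprint-grade 1 · textbook 0)**: `stub_printInputs` [CITE-ONLY — never a proof target, never benched] = (CGLS 2022 proof of Thm. 4.2.2, Thm. 5.1.3 (disc); Bleher et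
al. 2020 Thm. 3.3.1; de Shalit 1987 II.6.4) ∧ CGLS 2022 Thm. 2.1.2, and the CONTENT hypothesis stub 3a-A (`thm222_anacong_goodLattice_of_fullDescentDatum`,
preprint-grade) — width seat w5 gen 12's `…OfNamedFactsV33P.goodLatticeBDPValue_of_namedFacts₃₃ₚ` with the Poitou–Tate THEOREM
`PoitouTateShaNaturalAtTC.forall_poitouTate_shaRestricted_tateDual_natural_at_of_isTotallyComplex` in v32's textbook slot.  CONDITIONAL on exactly these six
names; closes nothing by itself; BSD is proved for no curve.
[claim: KellerYin2024, status: under-review]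
[cite: KellerYin2024, Thm. 3.0.8 (IMC2)] [cite: Greenberg2016Selmer, Prop. 2.6.3 (c), Prop. 4.1.1] [cite: MilneADT2006, I Thm. 4.10 (a), I Thm. 5.1] -/
theorem goodLatticeBDPValue_of_namedFacts₃₃ₙ
    (stub_printInputs :
      (proofThm422_exists_isBDPLFunction_isTorsion_charIdeal_dvd ∧
        thm513_exists_isBDPLFunction_valueAtOne_disc ∧
        thm331_rubin_exists_katzMeasure₂_pseudoIso_span_eq ∧
        thmII64_katzMeasure₂_functionalEquation) ∧
      thm212_exists_isKatzLFunction)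
    (stub_anacongOfFullDescentDatum : thm222_anacong_goodLattice_of_fullDescentDatum) :
    Summit.BirchSwinnertonDyer.BirchSwinnertonDyer.Theses.EisensteinPrimes.GoodLatticeBDPValue :=
  GoodLatticeBDPValueOfNamedFactsV33P.goodLatticeBDPValue_of_namedFacts₃₃ₚ stub_printInputs.1 stub_anacongOfFullDescentDatum
    ⟨Summit.BirchSwinnertonDyer.BirchSwinnertonDyer.Theorems.PoitouTateShaNaturalAtTC.forall_poitouTate_shaRestricted_tateDual_natural_at_of_isTotallyComplex,
      stub_printInputs.2⟩

end Summit.BirchSwinnertonDyer.BirchSwinnertonDyer.Theorems.GoodLatticeBDPValueOfNamedFactsV33N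

end
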